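import Mathlib
import HarnessLib
import Literature.NumberTheory.LFunctions.RiemannXi
import Summits.RiemannHypothesis.RiemannHypothesis.Theorems.EarlyAppointmentsRemainder0XiEtaLedgerArith
import Summits.RiemannHypothesis.RiemannHypothesis.Theorems.EarlyAppointmentsRemainder0XiFarLogKernelBasics

/-!
# ⟨24730⟩ ρ2 v4 — Theorems-side mirrors of the two objects the v4 registry declares

C4 «kernel desk» rh-idea-6 g30, director (CA406).  The registry `Cruxes/Remainder0Xi/Lines/rho2_v4.lean`
(namespace `…Cruxes.Remainder0Xi.Rho2V4`) takes `T_PT, xiSpacing, boxHalfWidth, eta0, lowStart, mainIntegral` from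
the landed mirrors `…Rho2V2.*` (…EtaLedgerArith, …FarLogKernelBasics) by import and declares exactly two objects of
its own, `farField` (v2 registry body verbatim) and `errorBudget4 := 3/10`, and the two stub statements `FarAbel4`,
`FarLogKernelSharp4`.  This file declares the SAME four names with BYTE-IDENTICAL bodies on the Theorems side (Theorems files cannot import `Cruxes/…/Lines`), exactly as
…EtaLedgerArith mirrors v2's constants — so the closing theorems of the two v4 stubs can be stated BY NAME:
`…Theorems/EarlyAppointmentsRemainder0XiStubFarLogKernelSharp4` (stub 2, proved) and the FarAbel4 skeleton.
Definitions only.  Nothing here bears on the truth of RH; RH is not proved; 24730 OPEN.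
-/

set_option linter.dupNamespace false
namespace Summit.RiemannHypothesis.RiemannHypothesis.Cruxes.Remainder0Xi.Rho2V4

open Real Complex Literature.NumberTheory.LFunctions Set Filter
open Summit.RiemannHypothesis.RiemannHypothesis.Cruxes.Remainder0Xi.Rho2V2
  (T_PT xiSpacing boxHalfWidth eta0 lowStart mainIntegral)

/-- The far field (v2 registry `Lines/rho2_v2.lean` l.50–55 = v4 registry, body verbatim). -/
noncomputable def farField (w : ℂ) : ℂ :=
  deriv riemannXiUpper w / riemannXiUpper w -
    ∑ᶠ u ∈ {u : ℂ | riemannXiUpper u = 0 ∧ |u.re - w.re| < boxHalfWidth},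
      ((analyticOrderAt riemannXiUpper u).toNat : ℂ) * (w - u)⁻¹

/-- The v4 error budget of the Abel step, in s-shares (director (CA406); v4 registry verbatim). -/
noncomputable abbrev errorBudget4 : ℝ := 3 / 10

/-- **FarAbel4** (v4 registry verbatim): ‖FAR(w) − MAIN(Re w)‖ ≤ errorBudget4 / s(γ) on the box around `γ > T_PT`. -/
def FarAbel4 : Prop :=
  ∀ γ : ℝ, T_PT < γ → ∀ w : ℂ, |w.re - γ| ≤ boxHalfWidth → |w.im| ≤ eta0 →
    riemannXiUpper w ≠ 0 →
    ‖farField w - (mainIntegral w.re : ℂ)‖ ≤ errorBudget4 / xiSpacing γ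

/-- **FarLogKernelSharp4** (v4 registry verbatim): |MAIN(x)| ≤ (η₀ − errorBudget4) / s(γ) on the box. -/
def FarLogKernelSharp4 : Prop :=
  ∀ γ : ℝ, T_PT < γ → ∀ x : ℝ, |x - γ| ≤ boxHalfWidth →
    |mainIntegral x| ≤ (eta0 - errorBudget4) / xiSpacing γ

/-- (K) `farField` agrees with the v2-named Theorems mirror wherever that one is in scope: both are this term. -/
theorem farField_def (w : ℂ) : farField w = deriv riemannXiUpper w / riemannXiUpper w -
    ∑ᶠ u ∈ {u : ℂ | riemannXiUpper u = 0 ∧ |u.re - w.re| < boxHalfWidth},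
      ((analyticOrderAt riemannXiUpper u).toNat : ℂ) * (w - u)⁻¹ := rfl

end Summit.RiemannHypothesis.RiemannHypothesis.Cruxes.Remainder0Xi.Rho2V4
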